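import Literature.Geometry.Lorentzian.KerrSchildTimeTranslation
import HarnessLib

/-!
# `KerrShieldedDataExist`, line `plug-the-second-sheet` (skeleton v4 "KerrCap") — stub `stub_capShield`, II:
# reparametrisation naturality of the induced data, and reading them in two Kerr–Schild charts

Support file (`--supports stmt-FinalStateConjecture-10055`; everything proved, no definitions, no named facts)
for the registered stub `stub_capShield` of `Cruxes/KerrShieldedDataExist/Lines/plug_the_second_sheet.lean`.
The shielding block of the crux compares the datum induced by the cap map `Ψ : Ω → Kerr.region a r_c` on
`Ω = {‖u‖ > σ}`, pulled back by the end chart `φ : Kerr.slice a r_b → Ω`, with the datum induced by the pinned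
graph `ψ : Kerr.slice a r_b → Kerr.region a r_b`; since `Ψ ∘ φ = ψ + c ∂_{t*}`, this is (i) the naturality of
the induced metric, of the (future unit) normal and of the second fundamental form under REPARAMETRISATION by a
smooth map of chart domains, (ii) `t*`-translation invariance (`KerrSchildTimeTranslation.lean`, in the tree) and
(iii) independence of the chart `Kerr.region a r` in which the Kerr–Schild components `Kerr.bilin M a` are read.
This file proves (i) and (iii):

* `KerrCap.mfderiv_comp_of_repr`, `pullbackBilin_comp_of_repr` — chain rule `d(f ∘ σ)_z = df_{σ z} ∘ Dσ̃(z)` for a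
  map `σ : W → U` of chart domains with representative `σ̃`, and `((f ∘ σ)^* b)_z(v, w) = (f^* b)_{σ z}(Dσ̃ v, Dσ̃ w)`;
* `KerrCap.isFutureUnitNormal_comp` — `ν ∘ σ` is the future unit normal of `f ∘ σ` if `ν` is that of `f`;
* `KerrCap.secondFundamentalForm_comp_of_repr` — **`K_{ν∘σ}(f ∘ σ)_z(v, w) = K_ν(f)_{σ z}(Dσ̃ v, Dσ̃ w)`**: in the
  coordinate formula `K = g(DN v + Γ(N)(DΦ v), DΦ w)` (`OpensChart.secondFundamentalForm_eq_of_repr`) the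
  representatives of `f ∘ σ`, `ν ∘ σ` are `Φ ∘ σ̃`, `N ∘ σ̃`, differentiated by the chain rule (O'Neill 1983, Ch. 4,
  Lemma 4.4: the shape tensor is a tensor; Prop. 4.8);
* `KerrCap.pullbackBilin_kerrChart_eq`, `isFutureUnitNormal_kerrChart`, `secondFundamentalForm_kerrChart_eq` — two maps
  `f : U → Kerr.region a r_c`, `f' : U → Kerr.region a r_b` with the SAME representative, and fields with the same
  values along them, have the same induced metric, the same future-unit-normal property and the same second
  fundamental form (both metrics have components `Kerr.bilin M a`, both orientations the field `Kerr.timeVector M a`;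
  the Christoffel map is built from `∂G` at the point and index raising by `G x`, `OpensChart.sharp_eq_of_val_eq`).

References: B. O'Neill, *Semi-Riemannian geometry* (1983), Ch. 3, Prop. 3.13; Ch. 4, Lemma 4.1, Lemma 4.4,
Prop. 4.8, pp. 104–107; Ch. 5, p. 145. R. M. Wald, *General Relativity* (1984), §10.2, (10.2.13).
-/

-- the doubled `FinalStateConjecture` path component is the summit/problem naming scheme, not a mistake
set_option linter.dupNamespace false

-- instance search through the nested operator type `E →L[ℝ] E →L[ℝ] ℝ` (as in the tree files)
set_option maxSynthPendingDepth 3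

noncomputable section

open Set Function Filter Topology TopologicalSpace
open scoped Manifold ContDiff Topology InnerProductSpace
open Literature.Geometry.Lorentzian

namespace Summit.FinalStateConjecture.FinalStateConjecture.Theorems.SwallowTheDatum

namespace KerrCap

/-! ### Reparametrisation of maps between chart domains -/

section Reparam

variable {E : Type*} [NormedAddCommGroup E] [NormedSpace ℝ E]
  {E' : Type*} [NormedAddCommGroup E'] [NormedSpace ℝ E']
  {E'' : Type*} [NormedAddCommGroup E''] [NormedSpace ℝ E'']
  {V : Opens E} {U : Opens E'} {W : Opens E''}
  {f : U → V} {σ : W → U} {σr : E'' → E'} (hσ : ∀ z : W, (σ z : E') = σr z)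
include hσ

/-- **Chain rule through a map of chart domains**: `d(f ∘ σ)_z v = df_{σ z}(Dσ̃(z) v)` for `σ : W → U` with
representative `σ̃` differentiable at `z` and `f` differentiable at `σ z` (`mfderiv_comp` with
`OpensChart.mfderiv_apply_of_repr`). [folklore] -/
theorem mfderiv_comp_of_repr {z : W} (hσd : DifferentiableAt ℝ σr z)
    (hfd : MDifferentiableAt 𝓘(ℝ, E') 𝓘(ℝ, E) f (σ z)) (v : E'') :
    mfderiv 𝓘(ℝ, E'') 𝓘(ℝ, E) (f ∘ σ) z v = mfderiv 𝓘(ℝ, E') 𝓘(ℝ, E) f (σ z) (fderiv ℝ σr z v) := by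
  have hσm : MDifferentiableAt 𝓘(ℝ, E'') 𝓘(ℝ, E') σ z := OpensChart.mdifferentiableAt_of_repr hσ hσd
  rw [mfderiv_comp z hfd hσm]
  show mfderiv 𝓘(ℝ, E') 𝓘(ℝ, E) f (σ z) (mfderiv 𝓘(ℝ, E'') 𝓘(ℝ, E') σ z v) = _
  rw [OpensChart.mfderiv_apply_of_repr hσ hσd]

/-- The reparametrised map is differentiable where the data are. [folklore] -/
theorem mdifferentiableAt_comp_of_repr {z : W} (hσd : DifferentiableAt ℝ σr z)
    (hfd : MDifferentiableAt 𝓘(ℝ, E') 𝓘(ℝ, E) f (σ z)) : MDifferentiableAt 𝓘(ℝ, E'') 𝓘(ℝ, E) (f ∘ σ) z :=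
  hfd.comp z (OpensChart.mdifferentiableAt_of_repr hσ hσd)

/-- **Naturality of the pull-back under reparametrisation**, pointwise:
`((f ∘ σ)^* b)_z(v, w) = (f^* b)_{σ z}(Dσ̃ v, Dσ̃ w)`. O'Neill 1983, Ch. 3, p. 58. [cite: ONeill1983, Ch. 3, p. 58] -/
theorem pullbackBilin_comp_of_repr {z : W} (hσd : DifferentiableAt ℝ σr z)
    (hfd : MDifferentiableAt 𝓘(ℝ, E') 𝓘(ℝ, E) f (σ z))
    (b : Π x : V, TangentSpace 𝓘(ℝ, E) x →L[ℝ] TangentSpace 𝓘(ℝ, E) x →L[ℝ] ℝ) (v w : E'') :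
    pullbackBilin (I := 𝓘(ℝ, E)) (I' := 𝓘(ℝ, E'')) (f ∘ σ) b z v w =
      pullbackBilin (I := 𝓘(ℝ, E)) (I' := 𝓘(ℝ, E')) f b (σ z) (fderiv ℝ σr z v) (fderiv ℝ σr z w) := by
  rw [pullbackBilin_apply, pullbackBilin_apply, mfderiv_comp_of_repr hσ hσd hfd, mfderiv_comp_of_repr hσ hσd hfd]
  rfl

variable {n : ℕ∞ω}

/-- **A normal field restricts along a reparametrisation**: if `ν` is normal to `f`, then `ν ∘ σ` is normal
to `f ∘ σ` (the tangent spaces of `f ∘ σ` lie in those of `f`). O'Neill 1983, Ch. 4, p. 98. [cite: ONeill1983, Ch. 4, p. 98] -/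
theorem isNormalTo_comp {g : PseudoRiemannianMetric 𝓘(ℝ, E) n E (TangentSpace 𝓘(ℝ, E) : V → Type _)}
    (hσd : ∀ z : W, DifferentiableAt ℝ σr z) (hfd : ∀ y : U, MDifferentiableAt 𝓘(ℝ, E') 𝓘(ℝ, E) f y)
    {ν : NormalField 𝓘(ℝ, E) f} (hn : g.IsNormalTo 𝓘(ℝ, E') f ν) :
    g.IsNormalTo 𝓘(ℝ, E'') (f ∘ σ) (fun z ↦ ν (σ z)) := by
  intro z v
  rw [mfderiv_comp_of_repr hσ (hσd z) (hfd (σ z))]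
  exact hn (σ z) _

/-- **A unit normal restricts along a reparametrisation.** [cite: ONeill1983, Ch. 4, pp. 106–107] -/
theorem isUnitNormal_comp {g : PseudoRiemannianMetric 𝓘(ℝ, E) n E (TangentSpace 𝓘(ℝ, E) : V → Type _)}
    (hσd : ∀ z : W, DifferentiableAt ℝ σr z) (hfd : ∀ y : U, MDifferentiableAt 𝓘(ℝ, E') 𝓘(ℝ, E) f y)
    {ν : NormalField 𝓘(ℝ, E) f} {ε : ℝ} (hun : g.IsUnitNormal 𝓘(ℝ, E') f ν ε) :
    g.IsUnitNormal 𝓘(ℝ, E'') (f ∘ σ) (fun z ↦ ν (σ z)) ε :=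
  ⟨isNormalTo_comp hσ hσd hfd hun.1, fun z ↦ hun.2 (σ z)⟩

/-- **The future unit normal restricts along a reparametrisation**: if `ν` is the future unit normal of
`f : U → V` then `ν ∘ σ` is the future unit normal of `f ∘ σ` (unit length and future-directedness are read at
the point `f (σ z)`). O'Neill 1983, Ch. 5, p. 145; Wald 1984, §10.2. [cite: ONeill1983, Ch. 5, p. 145] -/
theorem isFutureUnitNormal_comp {gL : LorentzianMetric 𝓘(ℝ, E) n V} {τ : TimeOrientation gL}
    (hσd : ∀ z : W, DifferentiableAt ℝ σr z) (hfd : ∀ y : U, MDifferentiableAt 𝓘(ℝ, E') 𝓘(ℝ, E) f y)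
    {ν : NormalField 𝓘(ℝ, E) f} (hfun : gL.IsFutureUnitNormal 𝓘(ℝ, E') τ f ν) :
    gL.IsFutureUnitNormal 𝓘(ℝ, E'') τ (f ∘ σ) (fun z ↦ ν (σ z)) :=
  ⟨isUnitNormal_comp (g := gL.toPseudoRiemannianMetric) hσ hσd hfd hfun.1, fun z ↦ hfun.2 (σ z)⟩

/-- **Reparametrisation naturality of the second fundamental form.** Let `g` be a metric on `V ⊆ E` with
components `G`, `f : U → V` with representative `Φ`, `ν` a field along `f` with representative `N`, and
`σ : W → U` a map of chart domains with representative `σ̃`. At a point `z` where `σ̃` is differentiable and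
`Φ`, `N`, `G` are differentiable at `σ z` (resp. `f (σ z)`),
`K_{ν∘σ}(f ∘ σ)_z(v, w) = K_ν(f)_{σ z}(Dσ̃(z) v, Dσ̃(z) w)`: the representatives of `f ∘ σ` and `ν ∘ σ` are
`Φ ∘ σ̃` and `N ∘ σ̃`, and in `K = g(DN v + Γ(N)(DΦ v), DΦ w)` (`OpensChart.secondFundamentalForm_eq_of_repr`) the
chain rule gives `D(N ∘ σ̃) v = DN(Dσ̃ v)`, `D(Φ ∘ σ̃) v = DΦ(Dσ̃ v)`. O'Neill 1983, Ch. 4, Lemma 4.4 and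
Prop. 4.8 (the shape tensor is a tensor field on the hypersurface). [cite: ONeill1983, Ch. 4, Lemma 4.4] -/
theorem secondFundamentalForm_comp_of_repr [FiniteDimensional ℝ E] [FiniteDimensional ℝ E']
    [FiniteDimensional ℝ E''] {g : PseudoRiemannianMetric 𝓘(ℝ, E) n E (TangentSpace 𝓘(ℝ, E) : V → Type _)}
    [g.HasLeviCivita] {G : E → E →L[ℝ] E →L[ℝ] ℝ} (hG : ∀ x : V, g.val x = G x) {Φ : E' → E}
    (hf : ∀ y : U, (f y : E) = Φ y) {ν : NormalField 𝓘(ℝ, E) f} {N : E' → E} (hν : ∀ y : U, ν y = N y)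
    {z : W} (hσd : DifferentiableAt ℝ σr z) (hΦ : DifferentiableAt ℝ Φ (σ z))
    (hN : DifferentiableAt ℝ N (σ z)) (hGd : DifferentiableAt ℝ G (f (σ z))) (v w : E'') :
    g.secondFundamentalForm 𝓘(ℝ, E'') (f ∘ σ) (fun z ↦ ν (σ z)) z v w =
      g.secondFundamentalForm 𝓘(ℝ, E') f ν (σ z) (fderiv ℝ σr z v) (fderiv ℝ σr z w) := by
  have hz : (σ z : E') = σr z := hσ z
  have hf' : ∀ z : W, (((f ∘ σ) z : V) : E) = (Φ ∘ σr) z := fun z ↦ by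
    simp only [Function.comp_apply, hf, hσ]
  have hν' : ∀ z : W, (fun z ↦ ν (σ z)) z = (N ∘ σr) z := fun z ↦ by
    simp only [Function.comp_apply, hν, hσ]
  have hΦ' : DifferentiableAt ℝ Φ (σr z) := hz ▸ hΦ
  have hN' : DifferentiableAt ℝ N (σr z) := hz ▸ hN
  have hΦσ : DifferentiableAt ℝ (Φ ∘ σr) z := hΦ'.comp _ hσd
  have hNσ : DifferentiableAt ℝ (N ∘ σr) z := hN'.comp _ hσd
  have hGd' : DifferentiableAt ℝ G ((f ∘ σ) z) := hGd
  rw [OpensChart.secondFundamentalForm_eq_of_repr hG hf' hν' hΦσ hNσ hGd' v w,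
    OpensChart.secondFundamentalForm_eq_of_repr hG hf hν hΦ hN hGd _ _, fderiv_comp (z : E'') hΦ' hσd,
    fderiv_comp (z : E'') hN' hσd]
  simp only [Function.comp_apply, ContinuousLinearMap.coe_comp, hz]
  rfl

end Reparam

/-! ### Reading the induced data in two Kerr–Schild charts `Kerr.region a r_c`, `Kerr.region a r_b` -/

section KerrChart

variable [Kerr.Facts] {E' : Type*} [NormedAddCommGroup E'] [NormedSpace ℝ E'] {U : Opens E'}
  {M a rb rc : ℝ} {f : U → Kerr.region a rc} {f' : U → Kerr.region a rb} {Φ : E' → E4}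
  (hf : ∀ y : U, (f y : E4) = Φ y) (hf' : ∀ y : U, (f' y : E4) = Φ y)
include hf hf'

omit [Kerr.Facts] [NormedSpace ℝ E'] in
/-- Two corestrictions of one map into two Kerr–Schild chart domains have the same underlying points. [folklore] -/
theorem coe_kerrChart_eq (y : U) : ((f' y : Kerr.region a rb) : E4) = (f y : E4) := by rw [hf, hf']

/-- **The induced metric does not depend on the chart domain `Kerr.region a r` in which it is read**: for
`f : U → Kerr.region a r_c` and `f' : U → Kerr.region a r_b` with a common representative `Φ`, differentiable
at `y`, `(f^* g_{M,a})_y = (f'^* g_{M,a})_y` (both are `Kerr.bilin M a (Φ y) (DΦ ·, DΦ ·)`). O'Neill 1983,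
Ch. 4, p. 97. [cite: ONeill1983, Ch. 4, p. 97] -/
theorem pullbackBilin_kerrChart_eq {y : U} (hΦ : DifferentiableAt ℝ Φ y) :
    pullbackBilin (I := 𝓘(ℝ, E4)) (I' := 𝓘(ℝ, E')) f (Kerr.smoothMetric M a rc).val y =
      pullbackBilin (I := 𝓘(ℝ, E4)) (I' := 𝓘(ℝ, E')) f' (Kerr.smoothMetric M a rb).val y := by
  ext v w
  rw [pullbackBilin_apply, pullbackBilin_apply, OpensChart.mfderiv_apply_of_repr hf hΦ,
    OpensChart.mfderiv_apply_of_repr hf hΦ, OpensChart.mfderiv_apply_of_repr hf' hΦ,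
    OpensChart.mfderiv_apply_of_repr hf' hΦ, Kerr.smoothMetric_val, Kerr.smoothMetric_val, coe_kerrChart_eq hf hf']
  rfl

/-- **A spacelike immersion stays spacelike when read in another chart domain** (common representative,
`C^∞` on `U`). [cite: ONeill1983, Ch. 4, p. 97] -/
theorem isSpacelikeImmersion_kerrChart (hΦ : ∀ y : U, DifferentiableAt ℝ Φ y)
    (hf's : ContMDiff 𝓘(ℝ, E') 𝓘(ℝ, E4) ∞ f') (hsp : (Kerr.smoothMetric M a rc).IsSpacelikeImmersion 𝓘(ℝ, E') f) :
    (Kerr.smoothMetric M a rb).IsSpacelikeImmersion 𝓘(ℝ, E') f' := by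
  refine ⟨hf's, fun y v hv ↦ ?_⟩
  have h := hsp.2 y v hv
  rw [PseudoRiemannianMetric.inducedBilin] at h ⊢
  rw [← pullbackBilin_kerrChart_eq hf hf' (hΦ y)]
  exact h

/-- **The future-unit-normal property does not depend on the chart domain in which it is read**: for
`f : U → Kerr.region a r_c`, `f' : U → Kerr.region a r_b` with a common representative `Φ` (differentiable on
`U`) and fields `ν, ν'` along them with the same values, `ν` future unit normal of `f` (metric
`Kerr.smoothMetric M a r_c`, orientation `Kerr.timeOrientation M a r_c`) implies the same for `ν'` along `f'`
with `r_b` (the components `Kerr.bilin M a x`, the orienting field `Kerr.timeVector M a x` and `df = DΦ = df'`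
are literally the same). Wald 1984, §10.2. [cite: Wald1984, §10.2] -/
theorem isFutureUnitNormal_kerrChart (hM : 0 ≤ M) (hΦ : ∀ y : U, DifferentiableAt ℝ Φ y)
    {ν : NormalField 𝓘(ℝ, E4) f} {ν' : NormalField 𝓘(ℝ, E4) f'} (hνν' : ∀ y, ν' y = ν y)
    (hfun : (Kerr.smoothMetric M a rc).IsFutureUnitNormal 𝓘(ℝ, E')
      ((Kerr.timeOrientation M a rc hM).ofLE le_top) f ν) :
    (Kerr.smoothMetric M a rb).IsFutureUnitNormal 𝓘(ℝ, E') ((Kerr.timeOrientation M a rb hM).ofLE le_top) f' ν' := by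
  have hx : ∀ y : U, ((f' y : Kerr.region a rb) : E4) = (f y : E4) := coe_kerrChart_eq hf hf'
  refine ⟨⟨fun y v ↦ ?_, fun y ↦ ?_⟩, fun y ↦ ?_⟩
  · have h := hfun.1.1 y v
    rw [OpensChart.mfderiv_apply_of_repr hf (hΦ y), Kerr.smoothMetric_val] at h
    rw [OpensChart.mfderiv_apply_of_repr hf' (hΦ y), Kerr.smoothMetric_val, hνν', hx]
    exact h
  · have h := hfun.1.2 y
    rw [Kerr.smoothMetric_val] at h
    rw [Kerr.smoothMetric_val, hνν', hx]
    exact h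
  · have h := hfun.2 y
    simp only [TimeOrientation.IsFutureDirected, LorentzianMetric.IsCausal, TimeOrientation.vectorField_ofLE,
      Kerr.smoothMetric_val] at h ⊢
    refine ⟨⟨?_, ?_⟩, ?_⟩
    · have h1 := h.1.1
      rw [hνν', hx]
      exact h1
    · have h1 := h.1.2
      rw [hνν']
      exact h1
    · have h1 := h.2
      change Kerr.bilin M a (f y : E4) (Kerr.timeVector M a (f y : E4)) (ν y) < 0 at h1
      change Kerr.bilin M a (f' y : E4) (Kerr.timeVector M a (f' y : E4)) (ν' y) < 0
      rw [hνν', hx]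
      exact h1

/-- **The second fundamental form does not depend on the chart domain in which it is read**: for
`f : U → Kerr.region a r_c`, `f' : U → Kerr.region a r_b` with a common representative `Φ` and fields `ν, ν'`
along them with a common representative `N`, both differentiable at `y`,
`K_ν(f)_y(v, w) = K_{ν'}(f')_y(v, w)`: in `K = g(DN v + Γ(N)(DΦ v), DΦ w)`
(`OpensChart.secondFundamentalForm_eq_of_repr`) the Christoffel map `Γ_x = ♯(½ 𝒦)` is built from `∂(Kerr.bilin M a)`
at the common point and index raising by the common value `Kerr.bilin M a x` (`OpensChart.sharp_eq_of_val_eq`).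
O'Neill 1983, Ch. 3, Prop. 3.13; Ch. 4, Lemma 4.1 and 4.4. [cite: ONeill1983, Ch. 4, Lemma 4.1 and Lemma 4.4] -/
theorem secondFundamentalForm_kerrChart_eq [FiniteDimensional ℝ E'] [(Kerr.smoothMetric M a rc).HasLeviCivita]
    [(Kerr.smoothMetric M a rb).HasLeviCivita] {ν : NormalField 𝓘(ℝ, E4) f} {ν' : NormalField 𝓘(ℝ, E4) f'}
    {N : E' → E4} (hν : ∀ y : U, ν y = N y) (hν' : ∀ y : U, ν' y = N y) {y : U} (hΦ : DifferentiableAt ℝ Φ y)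
    (hN : DifferentiableAt ℝ N y) (v w : E') :
    (Kerr.smoothMetric M a rc).secondFundamentalForm 𝓘(ℝ, E') f ν y v w =
      (Kerr.smoothMetric M a rb).secondFundamentalForm 𝓘(ℝ, E') f' ν' y v w := by
  have hx : ((f' y : Kerr.region a rb) : E4) = (f y : E4) := coe_kerrChart_eq hf hf' y
  have hGd : DifferentiableAt ℝ (Kerr.bilin M a) (f y) := Kerr.differentiableAt_bilin M a (f y)
  have hGd' : DifferentiableAt ℝ (Kerr.bilin M a) (f' y) := Kerr.differentiableAt_bilin M a (f' y)
  have hval : ((Kerr.smoothMetric M a rb).val (f' y) : E4 →L[ℝ] E4 →L[ℝ] ℝ) = (Kerr.smoothMetric M a rc).val (f y) := by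
    rw [Kerr.smoothMetric_val, Kerr.smoothMetric_val, hx]
  rw [OpensChart.secondFundamentalForm_eq_of_repr (g := (Kerr.smoothMetric M a rc).toPseudoRiemannianMetric)
      (Kerr.smoothMetric_val_eq_bilin M a rc) hf hν hΦ hN hGd v w,
    OpensChart.secondFundamentalForm_eq_of_repr (g := (Kerr.smoothMetric M a rb).toPseudoRiemannianMetric)
      (Kerr.smoothMetric_val_eq_bilin M a rb) hf' hν' hΦ hN hGd' v w]
  have hΓ : (OpensChart.christoffel (Kerr.smoothMetric M a rb).toPseudoRiemannianMetric (Kerr.bilin M a) (f' y) (N y)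
        (fderiv ℝ Φ y v) : E4) =
      OpensChart.christoffel (Kerr.smoothMetric M a rc).toPseudoRiemannianMetric (Kerr.bilin M a) (f y) (N y)
        (fderiv ℝ Φ y v) := by
    rw [OpensChart.christoffel_apply, OpensChart.christoffel_apply, hx]
    exact OpensChart.sharp_eq_of_val_eq hval _
  rw [hΓ]
  exact (congrFun (congrArg DFunLike.coe (congrFun (congrArg DFunLike.coe hval) _)) _).symm

end KerrChart

end KerrCap

/-- **Registered export of this file** (sub-goal `cap_reparam` of stub `stub_capShield`): reparametrisation
naturality of the second fundamental form in a Kerr–Schild chart, `K_{ν∘σ}(f ∘ σ)_z(v, w) = K_ν(f)_{σ z}(Dσ̃ v, Dσ̃ w)`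
(`KerrCap.secondFundamentalForm_comp_of_repr` with `G = Kerr.bilin M a`, differentiable on the chart domain).
[cite: ONeill1983, Ch. 4, Lemma 4.4] -/
theorem cap_reparam :
    ∀ [Kerr.Facts] {M a rc : ℝ} {U W : Opens E3} {f : U → Kerr.region a rc} {σ : W → U} {σr : E3 → E3} {Φ N : E3 → E4} {ν : NormalField 𝓘(ℝ, E4) f} [(Kerr.smoothMetric M a rc).HasLeviCivita], (∀ z : W, (σ z : E3) = σr z) → (∀ y : U, (f y : E4) = Φ y) → (∀ y : U, ν y = N y) → ∀ {z : W}, DifferentiableAt ℝ σr z → DifferentiableAt ℝ Φ (σ z) → DifferentiableAt ℝ N (σ z) → ∀ (v w : E3), (Kerr.smoothMetric M a rc).secondFundamentalForm 𝓘(ℝ, E3) (f ∘ σ) (fun z ↦ ν (σ z)) z v w = (Kerr.smoothMetric M a rc).secondFundamentalForm 𝓘(ℝ, E3) f ν (σ z) (fderiv ℝ σr z v) (fderiv ℝ σr z w) :=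
  fun hσ hf hν _ hσd hΦ hN v w ↦
    KerrCap.secondFundamentalForm_comp_of_repr hσ (Kerr.smoothMetric_val_eq_bilin _ _ _) hf hν hσd hΦ hN
      (Kerr.differentiableAt_bilin _ _ _) v w

end Summit.FinalStateConjecture.FinalStateConjecture.Theorems.SwallowTheDatum

end
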